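import Literature.Geometry.Kaehler.RiemannSurfaceOnePole
import HarnessLib

/-!
# Two functions with poles of CONSECUTIVE exact orders at a point of a compact Riemann surface
# (the kernel of the Mittag-Leffler obstruction map has dimension `≥ n − dim Ȟ¹`)

Layer `Literature/Geometry/Kaehler`, sequel of `RiemannSurfaceOnePole` (O. Forster, *Lectures on Riemann
Surfaces*, GTM 81 (1981), §14 Thm. 14.12: on a compact Riemann surface `M`, for every `p` there is `f`
holomorphic on `M ∖ {p}` with a pole of some exact order `m ≥ 1` at `p`, from the Cartan–Serre finiteness
of `Ȟ¹(𝔚, 𝒪)` for the two-set cover `𝔚 = {U₀ = (chart at p).source, U₁ = M ∖ {p}}`). The same Čech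
argument, run LINEARLY, controls WHICH exact pole orders occur (Forster §14.14–§16.10 road to Riemann's
inequality; R. Miranda, *Algebraic Curves and Riemann Surfaces*, GSM 5 (1995), Chapter VI §1, proof idea of
Theorem 1.9 / the «gap» count): the obstruction map

  `T_n : ℂⁿ → Ȟ¹(𝔚, 𝒪)`, `a ↦ Σ_{j<n} a_j · [± z^{-(j+1)}]`

is linear, so `dim ker T_n ≥ n − g'` with `g' = dim Ȟ¹(𝔚, 𝒪)` (rank–nullity); every `a ∈ ker T_n ∖ 0`
produces (exactly as in Thm. 14.12) a function holomorphic on `M ∖ {p}` with a pole of EXACT order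
`top(a) + 1`, `top(a)` the largest index of a non-zero coefficient (`exists_pole_of_coboundary`); a
subspace `K ≤ ℂⁿ` realises at least `dim K` distinct top indices (`finrank_le_card_tops`); and a subset of
`{0, …, n−1}` with more than `⌈n/2⌉` elements contains two consecutive integers
(`exists_consecutive_of_card`). With `n = 2g' + 2` this gives the main result

* **`exists_pole_consecutive`**: on a compact Riemann surface, for every `p` there are `f`, `g` holomorphic
  on `M ∖ {p}` with poles of exact orders `m` and `m + 1` at `p` (`m ≥ 1`), in the tree's form
  `(coord p)^m · f → c ≠ 0`, `(coord p)^{m+1} · g → d ≠ 0` along `𝓝[≠] p`.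

This is the input of `RiemannSurfaceCompactAlgebraicCurve` («every compact Riemann surface is an algebraic
curve», Miranda VI Thm. 1.9: the quotient `f/g` has a simple zero at `p`, i.e. multiplicity one).
PROOF-ONLY file (no definitions); everything is proved from the tree's `RiemannSurfaceOnePole`
(`poleCover`, `poleCochain`, `poleCocycle`, Cartan–Serre `FramedCover.finite_cohomology_one`) and Mathlib
linear algebra; no named facts. Written for the abc-iut cell's GAP-LEDGER row G-L4t12g4-1 (PART A, sub-row
A1), but purely classical.

## References

* O. Forster, *Lectures on Riemann Surfaces*, GTM 81, Springer (1981), §14 Thm. 14.12 (proof), §16.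
  [Forster1981]
* R. Miranda, *Algebraic Curves and Riemann Surfaces*, GSM 5, AMS (1995), Chapter VI §1 Theorem 1.9.
  [Miranda1995]
* H. Cartan, J.-P. Serre, C. R. Acad. Sci. Paris 237 (1953) 128–130. [CartanSerre1953]
-/

noncomputable section

open scoped Manifold ContDiff Topology
open Set Filter Function Complex

namespace Literature.Geometry.Kaehler

namespace RiemannSurface

/-! ### §1 Linear algebra: a subspace of `𝕜ⁿ` realises at least `dim` many top indices -/

section Pivot

variable {𝕜 : Type*} [Field 𝕜] {n : ℕ}

/-- A non-zero vector of `𝕜ⁿ` has a largest index with non-zero coefficient. [folklore] -/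
private theorem exists_top_index (a : Fin n → 𝕜) (ha : a ≠ 0) :
    ∃ i : Fin n, a i ≠ 0 ∧ ∀ j, a j ≠ 0 → j ≤ i := by
  classical
  set s : Finset (Fin n) := Finset.univ.filter fun i ↦ a i ≠ 0 with hs
  have hsne : s.Nonempty := by
    by_contra hemp
    rw [Finset.not_nonempty_iff_eq_empty] at hemp
    apply ha
    funext i
    by_contra hi
    have : i ∈ s := by rw [hs, Finset.mem_filter]; exact ⟨Finset.mem_univ _, hi⟩
    rw [hemp] at this
    exact absurd this (Finset.notMem_empty _)
  refine ⟨s.max' hsne, (Finset.mem_filter.1 (s.max'_mem hsne)).2, fun j hj ↦ s.le_max' j ?_⟩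
  rw [hs, Finset.mem_filter]
  exact ⟨Finset.mem_univ _, hj⟩

/-- **A subspace `K ≤ 𝕜ⁿ` realises at least `dim K` distinct top indices**: if `J` contains the top
index of every non-zero vector of `K`, then `dim K ≤ #J` (the coordinate projection `K → 𝕜^J` is
injective). [folklore] -/
private theorem finrank_le_card_of_tops (K : Submodule 𝕜 (Fin n → 𝕜)) (J : Finset (Fin n))
    (hJ : ∀ a ∈ K, a ≠ 0 → ∀ i, a i ≠ 0 → (∀ j, a j ≠ 0 → j ≤ i) → i ∈ J) :
    Module.finrank 𝕜 K ≤ J.card := by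
  classical
  -- the coordinate projection onto the indices in `J`
  let P : K →ₗ[𝕜] (↥J → 𝕜) :=
    { toFun := fun a j ↦ (a : Fin n → 𝕜) j
      map_add' := fun a b ↦ by ext j; rfl
      map_smul' := fun c a ↦ by ext j; rfl }
  have hP : Function.Injective P := by
    rw [← LinearMap.ker_eq_bot, Submodule.eq_bot_iff]
    intro a ha
    by_contra hne
    have hne' : (a : Fin n → 𝕜) ≠ 0 := fun h ↦ hne (Subtype.ext h)
    obtain ⟨i, hi, hmax⟩ := exists_top_index (a : Fin n → 𝕜) hne'
    have hiJ : i ∈ J := hJ a a.2 hne' i hi hmax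
    have h0 : P a ⟨i, hiJ⟩ = 0 := by rw [LinearMap.mem_ker.1 ha]; rfl
    exact hi h0
  calc Module.finrank 𝕜 K ≤ Module.finrank 𝕜 (↥J → 𝕜) := LinearMap.finrank_le_finrank_of_injective hP
    _ = J.card := by rw [Module.finrank_fintype_fun_eq_card, Fintype.card_coe]

end Pivot

/-! ### §2 Combinatorics: many elements below `n` force two consecutive ones -/

/-- A finite set of naturals `< n` with more than `⌈n/2⌉ = (n+1)/2` elements contains two consecutive
integers (otherwise `i ↦ i/2` is injective on it). [folklore] -/
private theorem exists_consecutive_of_card (S : Finset ℕ) {n : ℕ} (hS : ∀ i ∈ S, i < n)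
    (hcard : (n + 1) / 2 < S.card) : ∃ i, i ∈ S ∧ i + 1 ∈ S := by
  by_contra hno
  simp only [not_exists, not_and] at hno
  have hinj : Set.InjOn (fun i : ℕ ↦ i / 2) (S : Set ℕ) := by
    intro i hi i' hi' (h : i / 2 = i' / 2)
    by_contra hne
    rcases Nat.lt_or_gt_of_ne hne with hlt | hlt
    · have : i' = i + 1 := by omega
      exact hno i hi (this ▸ hi')
    · have : i = i' + 1 := by omega
      exact hno i' hi' (this ▸ hi)
  have hmaps : ∀ i ∈ S, (fun i : ℕ ↦ i / 2) i ∈ Finset.range ((n + 1) / 2) := by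
    intro i hi
    have := hS i hi
    rw [Finset.mem_range]
    show i / 2 < (n + 1) / 2
    omega
  have hle := Finset.card_le_card_of_injOn (fun i : ℕ ↦ i / 2) hmaps hinj
  rw [Finset.card_range] at hle
  omega

/-! ### §3 The function attached to a coboundary relation (Forster 14.12, parametrised) -/

variable {M : Type*} [TopologicalSpace M] [ChartedSpace ℂ M] [IsManifold 𝓘(ℂ, ℂ) ω M] [T2Space M]

/-- **The function of a coboundary relation.** If `δ b = Σ_{i<N} a_i · (±z^{-(i+1)})` for a Čech
`0`-cochain `b` of the two-set cover at `p`, and `i₀` is the largest index with `a_{i₀} ≠ 0`, then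
`f = b₁` (the component on `U₁ = M ∖ {p}`) is holomorphic on `M ∖ {p}` and has a pole of EXACT order
`i₀ + 1` at `p`: `(coord p)^{i₀+1} · f → a_{i₀} ≠ 0` along `𝓝[≠] p`. This is the proof of Forster's
Thm. 14.12 with the coefficients as parameters. [cite: Forster1981, §14 Thm. 14.12 (proof)] -/
theorem exists_pole_of_coboundary (p : M) {N : ℕ} {a : Fin N → ℂ} {b : (poleCover p).Cochain 0}
    (hb : (poleCover p).delta 0 b = ∑ i : Fin N, a i • poleCochain p (i + 1))
    {i₀ : Fin N} (hmax : ∀ i, a i ≠ 0 → i ≤ i₀) :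
    ∃ f : M → ℂ, MDifferentiableOn 𝓘(ℂ, ℂ) 𝓘(ℂ, ℂ) f {p}ᶜ ∧
      Tendsto (fun x ↦ coord p x ^ ((i₀ : ℕ) + 1) * f x) (𝓝[≠] p) (𝓝 (a i₀)) := by
  classical
  -- the functions
  set f : M → ℂ := (b ![1] : M → ℂ) with hf
  set b₀ : M → ℂ := (b ![0] : M → ℂ) with hb₀
  have hU1 : cechSet (poleCover p).U ![1] = {p}ᶜ := by rw [cechSet_fin_one]; rfl
  have hU0 : cechSet (poleCover p).U ![0] = (chartAt ℂ p).source := by rw [cechSet_fin_one]; rfl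
  have hfhol : MDifferentiableOn 𝓘(ℂ, ℂ) 𝓘(ℂ, ℂ) f {p}ᶜ := by
    rw [← hU1]; exact holFunOn.mdifferentiableOn _
  have hb₀hol : MDifferentiableOn 𝓘(ℂ, ℂ) 𝓘(ℂ, ℂ) b₀ (chartAt ℂ p).source := by
    rw [← hU0]; exact holFunOn.mdifferentiableOn _
  -- the relation `f = b₀ + Σ aᵢ z^{-(i+1)}` on the punctured chart domain
  have hrel : ∀ x ∈ (chartAt ℂ p).source \ {p}, f x = b₀ x + ∑ i : Fin N, a i * (coord p x)⁻¹ ^ ((i : ℕ) + 1) := by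
    intro x hx
    have hx' : x ∈ (poleCover p).U 0 ∩ (poleCover p).U 1 := ⟨hx.1, hx.2⟩
    have h1 := (poleCover p).delta_zero_apply_apply b 0 1 hx'
    rw [hb] at h1
    have hxJ : x ∈ cechSet (poleCover p).U ![0, 1] := by
      rw [mem_cechSet_iff, Fin.forall_fin_two]; exact hx'
    simp only [Finset.sum_apply, Submodule.coe_sum, Submodule.coe_smul, Pi.smul_apply, smul_eq_mul,
      HolomorphicLineBundle.trivial_coordChange, one_mul] at h1
    have e : ∀ i : Fin N, (poleCochain p ((i : ℕ) + 1) ![0, 1] : M → ℂ) x = (coord p x)⁻¹ ^ ((i : ℕ) + 1) := fun i ↦ by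
      rw [poleCochain_apply_of_mem p _ _ hxJ]
      simp [sgn]
    simp only [e] at h1
    rw [← hf, ← hb₀] at h1
    linear_combination -h1
  refine ⟨f, hfhol, ?_⟩
  -- the limit
  have hev : ∀ᶠ x in 𝓝[≠] p, x ∈ (chartAt ℂ p).source \ {p} := eventually_mem_source_diff p
  have hcoord : Tendsto (coord p) (𝓝[≠] p) (𝓝 0) := (tendsto_coord p).mono_left nhdsWithin_le_nhds
  have hb₀c : Tendsto b₀ (𝓝[≠] p) (𝓝 (b₀ p)) :=
    ((hb₀hol.continuousOn.continuousAt ((chartAt ℂ p).open_source.mem_nhds (mem_chart_source ℂ p))).tendsto).mono_left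
      nhdsWithin_le_nhds
  -- termwise limits
  have hterm : ∀ i : Fin N, Tendsto (fun x ↦ a i * (coord p x ^ ((i₀ : ℕ) + 1) * (coord p x)⁻¹ ^ ((i : ℕ) + 1)))
      (𝓝[≠] p) (𝓝 (a i * if i = i₀ then 1 else 0)) := by
    intro i
    by_cases hi : a i = 0
    · simp only [hi, zero_mul]; exact tendsto_const_nhds
    have hle : (i : ℕ) + 1 ≤ (i₀ : ℕ) + 1 := Nat.succ_le_succ (hmax i hi)
    refine Tendsto.const_mul _ ?_
    have heq : ∀ᶠ x in 𝓝[≠] p, coord p x ^ ((i₀ : ℕ) + 1) * (coord p x)⁻¹ ^ ((i : ℕ) + 1) =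
        coord p x ^ ((i₀ : ℕ) + 1 - ((i : ℕ) + 1)) := by
      filter_upwards [hev] with x hx
      rw [inv_pow, pow_sub₀ _ (coord_ne_zero hx.1 hx.2) hle]
    refine Tendsto.congr' (EventuallyEq.symm heq) ?_
    by_cases hii : i = i₀
    · subst hii
      simp only [Nat.sub_self, pow_zero, if_true]
      exact tendsto_const_nhds
    · have hlt : 0 < (i₀ : ℕ) + 1 - ((i : ℕ) + 1) := by
        have : (i : ℕ) < i₀ := lt_of_le_of_ne (hmax i hi) (fun h ↦ hii (Fin.ext h))
        omega
      rw [if_neg hii]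
      have h0 : (0 : ℂ) = 0 ^ ((i₀ : ℕ) + 1 - ((i : ℕ) + 1)) := (zero_pow hlt.ne').symm
      rw [h0]
      exact hcoord.pow _
  have hlim : Tendsto (fun x ↦ coord p x ^ ((i₀ : ℕ) + 1) * b₀ x +
      ∑ i : Fin N, a i * (coord p x ^ ((i₀ : ℕ) + 1) * (coord p x)⁻¹ ^ ((i : ℕ) + 1))) (𝓝[≠] p)
      (𝓝 (0 ^ ((i₀ : ℕ) + 1) * b₀ p + ∑ i : Fin N, a i * if i = i₀ then 1 else 0)) :=
    ((hcoord.pow _).mul hb₀c).add (tendsto_finsetSum _ fun i _ ↦ hterm i)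
  have hval : (0 : ℂ) ^ ((i₀ : ℕ) + 1) * b₀ p + ∑ i : Fin N, (a i * if i = i₀ then 1 else 0) = a i₀ := by
    rw [zero_pow (Nat.succ_ne_zero _), zero_mul, zero_add]
    simp [Finset.sum_ite_eq']
  rw [hval] at hlim
  refine hlim.congr' ?_
  filter_upwards [hev] with x hx
  rw [hrel x hx, mul_add, Finset.mul_sum]
  refine congr_arg _ (Finset.sum_congr rfl fun i _ ↦ ?_)
  ring

/-! ### §4 The obstruction map, its kernel, and two consecutive exact orders -/

/-- **An element of the kernel of the obstruction map is a coboundary relation**: if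
`Σ_{i<n} a_i · [±z^{-(i+1)}] = 0` in `Ȟ¹(𝔚, 𝒪)`, then `Σ a_i · (±z^{-(i+1)}) = δ b` for some `0`-cochain
`b`. [cite: Forster1981, §14 Thm. 14.12 (proof)] -/
theorem exists_coboundary_of_sum_eq_zero (p : M) {n : ℕ} {a : Fin n → ℂ}
    (ha : ∑ i : Fin n, a i • Literature.Algebra.Homology.NatCochain.Cohomology.mk _ 1 (poleCocycle p (i + 1)) =
      (0 : (poleCover p).cohomology 1)) :
    ∃ b : (poleCover p).Cochain 0, (poleCover p).delta 0 b = ∑ i : Fin n, a i • poleCochain p (i + 1) := by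
  have hsum : Literature.Algebra.Homology.NatCochain.Cohomology.mk _ 1 (∑ i, a i • poleCocycle p (i + 1)) = 0 := by
    rw [map_sum]
    simp only [map_smul]
    exact ha
  rw [Literature.Algebra.Homology.NatCochain.Cohomology.mk_eq_zero_iff,
    Literature.Algebra.Homology.NatCochain.mem_coboundaries_succ_iff] at hsum
  obtain ⟨b, hb⟩ := hsum
  refine ⟨b, ?_⟩
  rw [hb, Submodule.coe_sum]
  rfl

/-- **Two functions with poles of consecutive exact orders** (the «gap» count behind Miranda VI Thm. 1.9,
from Forster's Thm. 14.12 run linearly): on a compact Riemann surface, for every `p` there are `f`, `g`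
holomorphic on `M ∖ {p}` and `m ≥ 1` with `(coord p)^m · f → c ≠ 0` and `(coord p)^{m+1} · g → d ≠ 0`
along `𝓝[≠] p` — poles of exact orders `m` and `m + 1` at `p`. With `g' = dim Ȟ¹(𝔚, 𝒪)` (finite by
Cartan–Serre) and `n = 2g' + 2`: the kernel of `ℂⁿ → Ȟ¹`, `a ↦ Σ a_i [±z^{-(i+1)}]`, has dimension
`≥ g' + 2`, hence realises `≥ g' + 2 > ⌈n/2⌉` distinct exact pole orders among `1, …, n`, two of which
are consecutive. [cite: Forster1981, §14 Thm. 14.12; Miranda1995, Chapter VI Theorem 1.9] [cite: CartanSerre1953] -/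
theorem exists_pole_consecutive [CompactSpace M] (p : M) :
    ∃ (f g : M → ℂ) (m : ℕ) (c d : ℂ), 0 < m ∧ c ≠ 0 ∧ d ≠ 0 ∧
      MDifferentiableOn 𝓘(ℂ, ℂ) 𝓘(ℂ, ℂ) f {p}ᶜ ∧ MDifferentiableOn 𝓘(ℂ, ℂ) 𝓘(ℂ, ℂ) g {p}ᶜ ∧
      Tendsto (fun x ↦ coord p x ^ m * f x) (𝓝[≠] p) (𝓝 c) ∧
      Tendsto (fun x ↦ coord p x ^ (m + 1) * g x) (𝓝[≠] p) (𝓝 d) := by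
  classical
  haveI : IsManifold 𝓘(ℝ, ℂ) ∞ M := isManifold_real_of_isManifold_complex
  haveI : Module.Finite ℂ ((poleCover p).cohomology 1) :=
    (poleCover p).finite_cohomology_one (poleCover_covers p)
  set g' := Module.finrank ℂ ((poleCover p).cohomology 1) with hg'
  set n := 2 * g' + 2 with hn
  -- the obstruction map
  let v : Fin n → (poleCover p).cohomology 1 := fun i ↦
    Literature.Algebra.Homology.NatCochain.Cohomology.mk _ 1 (poleCocycle p (i + 1))
  let T : (Fin n → ℂ) →ₗ[ℂ] (poleCover p).cohomology 1 := Fintype.linearCombination ℂ v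
  -- rank–nullity: `dim ker T ≥ n − g' = g' + 2`
  have hdimK : g' + 2 ≤ Module.finrank ℂ (LinearMap.ker T) := by
    have h1 := LinearMap.finrank_range_add_finrank_ker T
    have h2 : Module.finrank ℂ (LinearMap.range T) ≤ g' := Submodule.finrank_le _
    rw [Module.finrank_fintype_fun_eq_card, Fintype.card_fin] at h1
    omega
  set K : Submodule ℂ (Fin n → ℂ) := LinearMap.ker T with hK
  -- the set of top indices realised by `K`
  set J : Finset (Fin n) := Finset.univ.filter fun i ↦
    ∃ a ∈ K, a i ≠ 0 ∧ ∀ j, a j ≠ 0 → j ≤ i with hJ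
  have hJtops : ∀ a ∈ K, a ≠ 0 → ∀ i, a i ≠ 0 → (∀ j, a j ≠ 0 → j ≤ i) → i ∈ J :=
    fun a ha _ i hi hmax ↦ by rw [hJ, Finset.mem_filter]; exact ⟨Finset.mem_univ _, a, ha, hi, hmax⟩
  have hcardJ : g' + 2 ≤ J.card := hdimK.trans (finrank_le_card_of_tops K J hJtops)
  -- as naturals: two consecutive top indices
  set S : Finset ℕ := J.image (fun i : Fin n ↦ (i : ℕ)) with hS
  have hScard : S.card = J.card := Finset.card_image_of_injective _ Fin.val_injective
  have hSlt : ∀ i ∈ S, i < n := by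
    intro i hi
    obtain ⟨i', -, rfl⟩ := Finset.mem_image.1 hi
    exact i'.2
  have hcons : ∃ i, i ∈ S ∧ i + 1 ∈ S := by
    refine exists_consecutive_of_card S hSlt ?_
    rw [hScard]
    have : (n + 1) / 2 = g' + 1 := by omega
    omega
  obtain ⟨i, hi, hi1⟩ := hcons
  obtain ⟨i₀, hi₀J, hi₀⟩ := Finset.mem_image.1 hi
  obtain ⟨i₁, hi₁J, hi₁⟩ := Finset.mem_image.1 hi1
  obtain ⟨-, a, haK, hai₀, hamax⟩ := (Finset.mem_filter.1 hi₀J)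
  obtain ⟨-, a', ha'K, ha'i₁, ha'max⟩ := (Finset.mem_filter.1 hi₁J)
  -- coboundary relations for `a` and `a'`
  have hTa : ∑ j : Fin n, a j • v j = 0 := by
    have h := LinearMap.mem_ker.1 haK
    rwa [Fintype.linearCombination_apply] at h
  have hTa' : ∑ j : Fin n, a' j • v j = 0 := by
    have h := LinearMap.mem_ker.1 ha'K
    rwa [Fintype.linearCombination_apply] at h
  obtain ⟨b, hb⟩ := exists_coboundary_of_sum_eq_zero p hTa
  obtain ⟨b', hb'⟩ := exists_coboundary_of_sum_eq_zero p hTa'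
  obtain ⟨f, hf, hflim⟩ := exists_pole_of_coboundary p hb hamax
  obtain ⟨g, hg, hglim⟩ := exists_pole_of_coboundary p hb' ha'max
  refine ⟨f, g, (i₀ : ℕ) + 1, a i₀, a' i₁, Nat.succ_pos _, hai₀, ha'i₁, hf, hg, hflim, ?_⟩
  have e : (i₀ : ℕ) + 1 + 1 = (i₁ : ℕ) + 1 := by rw [hi₀, hi₁]
  rw [e]
  exact hglim

end RiemannSurface

end Literature.Geometry.Kaehler

end
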